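import Mathlib
import HarnessLib
import HarnessLib.Audit
import Summits.Langlands.Statement

/-!
Route: WeightVelocityMonodromy

CLOSED (retired) 2026-08-15T13:48:47Z by operator:999:1257524 — reason: not-a-thesis: assembly does not conclude the sub-problem Statement — note: D-0027 §2.1 audit (human 2026-08-15: routes that do not decide the summit are removed): the assembly concludes `LocalIrreducibilityGL2 ∧ LocalIndecomposabilityGL2 ∧ MonodromyAtP`, not the sub-problem statement; a NEW conforming route may be opened from the same idea (generated `closes : … → _root_.L. The file is kept as the record of this route; refuted decls are indexed as negative knowledge (`ledger negatives`).

Route WeightVelocityMonodromy — "monodromy is the shadow of weight velocity" (card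
Langlands/Langlands/monodromy-from-weight-velocity).
It suffices to show X = MonodromyAtP: for every CM number field K there are reciprocity data Rec
(intended, as in the summit: Harris–Taylor
rec_v and Fontaine's B_dR / WD∘D_pst) such that for every n ≥ 2, every cuspidal π on GL_n(𝔸_K) whose
infinity type is L-algebraic and
regular, every ℓ, ι, every SEMISIMPLE ρ : Γ_K → GL_n(ℚ̄_ℓ) that is Satake–Frobenius compatible with
π at almost all places (so ρ ≅ r_{π,ι}),
and every v ∣ ℓ with (n ≥ 3 or 2[K_v:ℚ_ℓ] ≤ [K:ℚ]): LocalGlobalCompatibleAt Rec ι π ρ v, i.e. ι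
WD(ρ|Γ_{K_v})^{F-ss} ≅ rec_v(π_v) WITH ITS
MONODROMY OPERATOR. This is the v ∣ ℓ clause of `Corresponds` in direction (A) for the torsion-built
(HLTT/Scholze) representations; it is
known up to semisimplification with N_Gal ≺ N_aut (AHTW2026 Thm 1.2.1, Cor 1.2.2 via Cor 6.0.6), and
X is the missing EQUALITY OF MONODROMY
on exactly the sector where the card's mechanism has enough p-adic deformation directions (place
condition = Newton's dimension bound, see
RANKED CRUXES). Typed now: X (decl MonodromyAtP), its n = 2 Galois-side shadows
LocalIrreducibilityGL2 (2-regular weights) and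
LocalIndecomposabilityGL2 (all regular weights), the printed input AHTWSemisimpleLGC, and two
algebra lemmas (MonodromyRankFromChain,
GenericWDUnique — the latter shared verbatim with route EisensteinMonodromy). The mechanism's own
cruxes (WeightVelocityAtSteinbergPairs,
NonSplitGradedPiece, StrictTriangulationAtX) and the known engine CGSArcOrthogonality need
(φ,Γ)-modules over Robba rings and eigenvarieties,
absent from the tree: they are filed informal with definition requests, and the Assembly is
deliberately BLOCKED on their decl names.
Lean: `∀ (K : Type) [Field K] [NumberField K] [NumberField.IsCMField K], ∃ Rec :
Summit.Langlands.ReciprocityData K, ∀ (n : ℕ) hcpt (π :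
Literature.NumberTheory.Automorphic.CuspidalAutomorphicRepData n K hcpt) (T :
Literature.NumberTheory.Automorphic.InfinityType K n), 2 ≤ n → π.1.HasInfinityType T →
T.IsLAlgebraic → T.IsRegular → ∀ (ℓ : ℕ) [Fact ℓ.Prime] (ι : PadicAlgCl ℓ ≃+* ℂ) (ρ :
Literature.NumberTheory.GaloisRepresentations.FramedGaloisRep K (PadicAlgCl ℓ) n),
ρ.toGaloisRep.IsSemisimple → (∀ᶠ v in Filter.cofinite, Summit.Langlands.SatakeFrobCompatibleAt ι π.1
ρ v) → ∀ v, ((ℓ : ℕ) : NumberField.RingOfIntegers K) ∈ v.asIdeal → (3 ≤ n ∨ 2 *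
(v.asIdeal.ramificationIdx ℤ * v.asIdeal.inertiaDeg ℤ) ≤ Module.finrank ℚ K) →
Summit.Langlands.LocalGlobalCompatibleAt Rec ι π.1 ρ v` (decl MonodromyAtP; elaborated rc 0 in the
planner's Sketch.lean).
Assembly (informal until the three mechanism cruxes are typed): WeightVelocityAtSteinbergPairs ∧
NonSplitGradedPiece ∧ StrictTriangulationAtX
∧ CGSArcOrthogonality (known) ∧ AHTWSemisimpleLGC (printed 2026) ∧ MonodromyRankFromChain ∧
GenericWDUnique ⟹ LocalIrreducibilityGL2 ∧
LocalIndecomposabilityGL2 ∧ MonodromyAtP: per Steinberg segment Δ of π_v choose the strict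
refinement of StrictTriangulationAtX; for each
consecutive pair inside Δ, NonSplitGradedPiece gives c_i ≠ 0, CGSArcOrthogonality puts every leading
weight jet ψ in c_i^⊥, WeightVelocity makes
the jets plus ord span Hom(K_v^×, E), so ord ∉ c_i^⊥, i.e. the graded piece is NOT crystalline
(Ding2019SimpleL §3.1); Ding2019SimpleL Lem 3.2 +
MonodromyRankFromChain turn the chain into rank N_Gal^k ≥ rank N_aut^k on each Frobenius-eigenvalue
block, and with N_Gal ≺ N_aut
(AHTWSemisimpleLGC) and genericity of rec(π_v) (AHTW2026 Prop 6.0.5, GenericWDUnique) the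
F-semisimplified Weil–Deligne representations agree.

Rationale: WHY THIS LINE. Direction (A) over CM fields is known up to semisimplification at every place:
existence (HarrisLanTaylorThorneRMS2016,
Scholze2015 = fact Literature.NumberTheory.Automorphic.exists_galoisRep_of_regularAlgebraic), v ∤ ℓ
(VarmaFMS2024), v ∣ ℓ (AHTW2026
Thm 1.2.1: r_{π,ι}|Γ_{K_v} de Rham with the predicted weights, WD^{ss} ≅ ι⁻¹rec(π_v)^{ss}; Cor
1.2.2: WD^{F-ss} ≺ ι⁻¹rec(π_v)). The one
datum of `LocalGlobalCompatibleAt` at v ∣ ℓ still missing is the Jordan type of N. Every printed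
proof of N ≠ 0 either finds ρ in the
cohomology of a variety with semistable reduction (Caraiani2014, polarizable only) or runs an
automorphy-lifting theorem (AllenNewton2020 at
v ∤ ℓ, YangLGC2024 at v ∣ ℓ: GL_2, weight 0); torsion-built non-polarizable ρ have neither. This
line reads N off the ONE structure torsion
methods do provide, p-adic analytic variation: on the Res_{K/ℚ}GL_n eigenvariety
(HansenUniversalEigenvarieties2017, determinants
JohanssonNewton2019 Thm B) the family D_rig(ρ_y|Γ_{K_v}) is globally trianguline
(KedlayaPottharstXiao2014 Cor 6.3.10); at the point x of π
with a Steinberg pair (i,i+1) of π_v adjacent, δ_i/δ_{i+1} is special, and the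
Colmez–Greenberg–Stevens orthogonality (Colmez2010Linvariants
Thm 0.5 n=2/ℚ_p; Pottharst2016 §2.3; Ding2019SimpleL Thm 3.4, rank n, any K_v) puts every
first-order jet of the ratio in c^⊥,
c = [gr_i D_x] ∈ H¹(R(δ_i/δ_{i+1})) of dimension [K_v:ℚ_ℓ]+1, while c is crystalline iff ord ∈ c^⊥
(Ding2019SimpleL §3.1). Imported area:
p-adic Hodge theory in families, used as a PROOF of semistability-with-monodromy instead of a
computation of 𝓛 given semistability.
RANKED CRUXES. #2 WeightVelocityAtSteinbergPairs (informal) — for each consecutive pair inside a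
Steinberg segment of π_v the leading weight
jets of analytic arcs through x span E^{Σ_v} in the labelled gap coordinates (why it might fail:
Newton's bound dim ≥ [K⁺:ℚ]n+1 with [K⁺:ℚ]+1
gap-constant twist directions leaves [K⁺:ℚ](n−1) essential ones, so ≥ [K_v:ℚ_ℓ] is possible only for
n ≥ 3 or 2[K_v:ℚ_ℓ] ≤ [K:ℚ] — the
place condition of X — and even there a component may sit in a gap-degenerate hypersurface; open for
Bianchi forms at split p,
CalegariMazur2008, BarreraWilliams2019, GehrmannRosso2022 §5). #3 NonSplitGradedPiece (informal) — c
≠ 0 (why: for n = 2 forced by Kedlaya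
slopes off the bad locus unless every labelled gap is 1; for n ≥ 3 slopes protect only some pairs —
St_3 with weights (0,a,b): pair (1,2) iff
b < 2a, pair (2,3) iff b > 2a, never both — so an argument excluding critical companion
triangulations is needed; BreuilHellmannSchraen2019).
#4 StrictTriangulationAtX (informal) — some accessible refinement makes each segment consecutive and
lies off the KPX bad locus, i.e. D_rig is
strictly trianguline with the family's parameters in every label (why: KedlayaPottharstXiao2014 Rem
6.3.11 — the bad locus is necessary;
τ-partial criticality for unbalanced labelled gaps). #5 LocalIrreducibilityGL2, #6
LocalIndecomposabilityGL2 (typed, n = 2 shadows: ρ|Γ_{K_v}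
irreducible for 2-regular weights / never a sum of two characters, at special π_v; both open in
print for non-polarizable π; label-flipped
split sums are weakly admissible when [K_v:ℚ_ℓ] ≥ 2, so p-adic Hodge numerics alone do not forbid
them).
KILL CRITERIA. A cuspidal non-CM, non-base-change Bianchi point at a split p whose eigenvariety
component has constant weight at v refutes #2 in
the sector of X and closes the route; an automorphic x with a split interior Steinberg graded piece
(e.g. via a critical companion point)
refutes #3 for n ≥ 3 and shrinks X to n = 2; a refutation of #5/#6 (a regular cuspidal π with
ρ|Γ_{K_v} ≅ χ₁ ⊕ χ₂ at a special place)
kills the whole line (and contradicts reciprocity itself). A proof of X elsewhere (e.g.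
completed-cohomology LGC) moots it.
NOT DECOMPOSED YET. (i) n = 2 at places with 2[K_v:ℚ_ℓ] > [K:ℚ] (e.g. Bianchi forms at inert p):
dimensionally out of reach unless components
are oversize or a second-order CGS identity is found; (ii) the passage "chain of non-crystalline
pieces ⇒ N_Gal generic" per
Frobenius-eigenvalue block (AHTW2026 §6, Def 6.0.1: equal m-vectors do not alone give isomorphism;
the chain data are finer) — glue, to be
split off #3 once typed; (iii) the genuine Rec (B_dR, WD∘D_pst) — definition items of the summit;
(iv) N at v ∤ ℓ (route
EisensteinMonodromy) and irregular π (NonRegularWeightBarrier). A tensor trick π ⊠ AI(χ) to GL_4 was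
considered and DROPPED: the endoscopic
family only adds twist directions (ratio jets 0).
CHEAPEST FALSIFIER. The St_3 slope table above (done: it already shrank the card's claim "split
branch empty for gaps ≥ 2" to n = 2); next, a
kit job with Bianchi overconvergent modular symbols (BarreraWilliams2019 code path) at a weight-4
newform over ℚ(i), Steinberg at a split
p ≡ 1 (4): compute the slope-≤h ranks of H¹(Y₁(𝔫p), D_κ) for κ on the two coordinate lines through
(4,4); constancy along κ_v = 4 with
κ_v̄ moving (and drop along κ_v moving) would exhibit a weight-rigid-at-v component and refute #2
for n = 2.
TWO-LAYER PLAN. After #4 closes: #3 ⇐ (SlopeExclusion: numerics) → (CompanionExclusion: no critical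
companion point at x) → #3. After #2
closes for n = 2: X ⇐ X(n=2) ∧ X(n≥3), glued inside one ∃Rec (same witness), not as two items.
NUMBERS. dim W_{K^p} = 2[K⁺:ℚ]n − [K⁺:ℚ] + 1, l₀ = [K⁺:ℚ](n−1), Newton's bound dim X_x ≥ [K⁺:ℚ]n + 1
(HansenUniversalEigenvarieties2017
Thm 1.1.6); dim H¹(R_E(δ)) = [K_v:ℚ_ℓ] + 1 at special δ, crystalline classes = ord^⊥ ∩ … a
hyperplane (Ding2019SimpleL §3.1, Nakamura2009);
slope(δ_i/δ_{i+1}) = Σ_τ (g_τ − 1)/e_v at a Steinberg pair with labelled gaps g_τ.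
DEFINITION REQUESTS. PhiGammaModuleRobba (φ,Γ_F)-modules over (relative) Robba rings with
cohomology, duality, D_rig, Berger's
D_cris/D_st, triangulations, Kedlaya slopes; EigenvarietyResGLn (Hansen–Newton eigenvariety datum:
weight map, classical points with
refinements, Galois determinant, Newton's bound, KPX global triangulation); FontainePstData (the
genuine PstWeilDeligneData: B_dR and
WD∘D_pst). Cite fact wanted: AHTW2026 Thm 1.2.1 + Cor 1.2.2.
SUPPORT. CGSArcOrthogonality (informal; known: Ding2019SimpleL Thm 3.4 pulled back along ε ↦ s^m for
leading-order jets of arcs),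
AHTWSemisimpleLGC (typed ∃Rec rendering of the printed theorem), MonodromyRankFromChain (typed
matrix lemma: k-superdiagonal chains bound
rank N^k), GenericWDUnique (typed; same statement as EisensteinMonodromy's, attached by dedup).

Novelty: Searches (2026-08-15, this seat; remote APIs rate-limited: arXiv/OpenAlex/S2 HTTP 429, local searchd
reset; zbMATH and direct arXiv PDF fetch worked):
`lit search "Colmez invariant L dérivées valeurs propres Frobenius" --source zbmath` (1 hit:
zbl:1251.11080 = Colmez2010Linvariants);
`lit search --hybrid "eigenvariety dimension … Newton appendix Hansen"` (10 book hits, none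
relevant; Hansen–Newton cited via the sibling card
newton-bound-as-patching whose auditor READ arXiv:1412.1533 Thm 1.1.6); `lit galaxy search
"Universal eigenvarieties, trianguline Galois
representations" --star all` (queued > 90 s, no result); `lit read` (pages materialised and read):
arXiv:2607.11763 pp.1–8, 111–113 (AHTW2026:
Conj 1.1.2/1.1.3, Thm 1.2.1, Cor 1.2.2, §1.1 status list "v|p … [Hev24] under
decomposed-generic/non-Eisenstein hypotheses", §6 Def 6.0.1–6.0.2 (≺),
Lemma 6.0.3, Prop 6.0.5 (generic = open orbit), Cor 6.0.6); arXiv:1807.10862 pp.24–26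
(Ding2019SimpleL §3.1 𝓛(D)=[D]^⊥ of codimension 1,
H¹_e^⊥ = Hom_∞ hence "crystalline iff Hom_∞ ⊆ 𝓛(D)", Lemma 3.2, Thm 3.4 CGS formula, Prop 3.5);
arXiv:1203.5718 pp.49–51 (KedlayaPottharstXiao2014
Cor 6.3.10, Rem 6.3.11 "the bad locus Z is necessary", Thm 6.3.13); arXiv:2407.00288 p.1
(YangLGC2024: GL_2 weight 0 via an automorphy lifting
theorem); arXiv:1901.05490 p.1 (AllenNewton2020: v ∤ l, density-one l); plus the card's novelty
audit (refuter-novelty-audit-Langlands-Langlands-7-0: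
Pottharst2016 READ in full, Colmez2010Linvariants pp.13–17, Gehrma  [refs: 1412.1533, 2607.11763, 1807.10862, 1203.5718, 2407.00288, 1901.05490, AHTW2026, KedlayaPottharstXiao2014, YangLGC2024, AllenNewton2020, Pottharst2016, GehrmannRosso2022, BarreraWilliams2019, Kisin2003, Caraiani2014]

Barriers (technique_class: p-adic-families eigenvariety trianguline L-invariants): - technique_class: p-adic-families, eigenvariety, trianguline-phi-gamma-modules, L-invariants
- Literature.Barriers.Langlands.ShimuraVarietyRealizationBarrier: evaded — no realisation of π or ρ
in the cohomology of a variety (no weight spectral sequence, no nearby cycles) is used; ρ enters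
only through the determinant over the Betti eigenvariety of Res_{K/ℚ}GL_n (any CM K) and its
(φ,Γ)-module at v; the barrier's l₀ = [K⁺:ℚ](n−1) > 0 is paid, not evaded, in crux #2 (Newton's
bound dim W − l₀ fixes the deformation budget).
- Literature.Barriers.Langlands.TwistedEndoscopySelfDual: evaded — π need not be polarizable;
(conjugate) self-duality is used only inside the imported facts (HLTT/Scholze existence, AHTW2026
via U(n,n)), never in the mechanism, which works with the n-dimensional ρ directly.
- Literature.Barriers.Langlands.TaylorWilesNumericalCoincidence: engaged but not used — no patching
and no automorphy lifting (contrast AllenNewton2020, YangLGC2024); the same defect l₀ reappears as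
the number of ESSENTIAL eigenvariety directions, and crux #2 needs [K_v:ℚ_ℓ] of them per Steinberg
pair: the barrier's numerology is exactly what sets the place condition "n ≥ 3 or 2[K_v:ℚ_ℓ] ≤
[K:ℚ]" of X; honest bet: outside it (Bianchi forms at inert p) the line has no mechanism.
- Literature.Barriers.Langlands.NonRegularWeightBarrier: NOT evaded — π must be regular
(cohomological) for x to be a point of a Betti eigenvariety; the route is about the all-places
clause for regular π, and for

History (route lifecycle, newest last):
- 2026-08-15T13:48:47Z · CLOSED retired — not-a-thesis: assembly does not conclude the sub-problem Statement (operator:999:1257524)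

sub-problem: Langlands · status: closed(retired) · opened planner-plancard-Langlands-Langlands-monodrom-3380a8ed-0 2026-08-15T11:23:54Z · rev 1 · ledger route-Langlands-WeightVelocityMonodromy
GENERATED by the gate from the ledger (D-0016/17). Provers cite these decls: `theorem foo : Summit.Langlands.Langlands.Theses.WeightVelocityMonodromy.<Decl> := …` in Summits/Langlands/Langlands/Theorems/<Name>.lean.
-/

namespace Summit.Langlands.Langlands.Theses.WeightVelocityMonodromy

open scoped BigOperators Topology Manifold Classical MeasureTheory ProbabilityTheory Matrix InnerProductSpace ComplexConjugate ContinuousMap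
open Filter Set Function TopologicalSpace MeasureTheory

attribute [summit_statement] _root_.Langlands

/-- item stmt-Langlands-3756 · target · rank 0 · closed · moot by None · by planner
why it might fail: Believed (instance of reciprocity). As TYPED: ∃Rec is per field, so a proof must produce one datum serving all n, π, ℓ, v at once; a junk pst-datum cannot help (it must also carry N), but the genuine B_dR/D_pst are not yet constructible in the tree.
sources: AHTW2026, BuzzardGeeLMS2014, HarrisLanTaylorThorneRMS2016, Scholze2015, VarmaFMS2024, YangLGC2024
[target] X: for K CM there are reciprocity data Rec (intended genuine: Harris–Taylor rec_v, Fontaine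
B_dR/WD∘D_pst — same ∃Rec shape and placeholder status as the summit, AUDIT §Vacuity) such that for
n ≥ 2, π cuspidal with L-algebraic REGULAR infinity type, ρ semisimple and Satake–Frobenius
compatible with π at almost all v (ρ ≅ r_{π,ι}: Chebotarev + Brauer–Nesbitt), and v ∣ ℓ with (n ≥ 3
∨ 2[K_v:ℚ_ℓ] ≤ [K:ℚ]) ([K_v:ℚ_ℓ] = e·f typed as v.asIdeal.ramificationIdx ℤ * v.asIdeal.inertiaDeg
ℤ): LocalGlobalCompatibleAt Rec ι π ρ v — full Taylor Conj. 7 clause at v ∣ ℓ, monodromy included.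
Known: semisimplified version + N_Gal ≺ N_aut (AHTW2026 Thm 1.2.1, Cor 1.2.2). The place condition
is where Newton's bound leaves ≥ [K_v:ℚ_ℓ] essential deformation directions (crux #2); n = 2 at
places with 2[K_v:ℚ_ℓ] > [K:ℚ] is deliberately outside X. [difficulty: open-problem] -/
@[route_item "route-Langlands-WeightVelocityMonodromy"]
def MonodromyAtP : Prop :=
  ∀ (K : Type) [Field K] [NumberField K] [NumberField.IsCMField K], ∃ Rec : Summit.Langlands.ReciprocityData K, ∀ (n : ℕ) (hcpt : Literature.NumberTheory.Automorphic.isCompact_glFiniteIntegralLevel n K) (π : Literature.NumberTheory.Automorphic.CuspidalAutomorphicRepData n K hcpt) (T : Literature.NumberTheory.Automorphic.InfinityType K n), 2 ≤ n → π.1.HasInfinityType T → T.IsLAlgebraic → T.IsRegular → ∀ (ℓ : ℕ) [Fact ℓ.Prime] (ι : PadicAlgCl ℓ ≃+* ℂ) (ρ : Literature.NumberTheory.GaloisRepresentations.FramedGaloisRep K (PadicAlgCl ℓ) n), ρ.toGaloisRep.IsSemisimple → (∀ᶠ v : IsDedekindDomain.HeightOneSpectrum (NumberField.RingOfIntegers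 K) in Filter.cofinite, Summit.Langlands.SatakeFrobCompatibleAt ι π.1 ρ v) → ∀ v : IsDedekindDomain.HeightOneSpectrum (NumberField.RingOfIntegers K), ((ℓ : ℕ) : NumberField.RingOfIntegers K) ∈ v.asIdeal → (3 ≤ n ∨ 2 * (v.asIdeal.ramificationIdx ℤ * v.asIdeal.inertiaDeg ℤ) ≤ Module.finrank ℚ K) → Summit.Langlands.LocalGlobalCompatibleAt Rec ι π.1 ρ v

-- item stmt-Langlands-3876 · crux · rank 2 · closed · moot by None · by planner — informal only, no Lean statement yet:
--   [crux #2 — WEIGHT VELOCITY, the route's bet; informal until EigenvarietyResGLn / PhiGammaModuleRobba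
--   land] Setting: K CM, [K⁺:ℚ] = m, π cuspidal regular (L-)algebraic on GL_n(𝔸_K), n ≥ 2, ℓ = p, ι, v ∣
--   p with d_v := [K_v:ℚ_p], X = X_{K^p} the Hansen–Newton eigenvariety of Res_{K/ℚ}GL_n (weight space W
--   = (T(ℤ_p)/closure of units)^rig, dim 2mn − m + 1), x = x(π ⊗ suitable |det|-twist, R) the classical
--   point for an accessible refinement R at the places above p as in StrictTriangulationAtX (each
--   Steinberg segment Δ of π_v consecutive). For a consecutive pair (i, i+1) inside Δ let g_{τ,i} (τ :
--   K_v

-- item stmt-Langlands-3885 · crux · rank 3 · closed · moot by None · by planner — informal only, no Lean statement yet: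
--   [crux #3 — NON-SPLIT GRADED PIECE; informal until PhiGammaModuleRobba lands] Setting as in
--   WeightVelocityAtSteinbergPairs, with the strict triangulation Fil_• of D := D_rig(ρ|Γ_{K_v}) ⊗ E at
--   x given by StrictTriangulationAtX (parameters δ_1, …, δ_n restricted from the family; inside a
--   Steinberg segment Δ the ratios δ_i/δ_{i+1} are special: N_{K_v/ℚ_p}(z)|N(z)| ∏_τ τ(z)^{g_{τ,i} − 1},
--   g_{τ,i} ≥ 1 the labelled gaps). CLAIM: for every consecutive pair (i, i+1) inside Δ the rank-2
--   graded piece gr_i := Fil_{i+1}/Fil_{i−1} is NON-SPLIT, i.e. its class c_i ∈ H¹_{φ,γ}(R_E(δ_i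
--   δ_{i+1}^{-1})) (dimension

-- item stmt-Langlands-3881 · crux · rank 4 · closed · moot by None · by planner — informal only, no Lean statement yet:
--   [crux #4 — STRICT TRIANGULATION AT x; informal until PhiGammaModuleRobba / EigenvarietyResGLn land]
--   Setting as above. CLAIM: for every Steinberg segment Δ of π_v (a segment of rec(π_v), length ≥ 2)
--   there is an accessible refinement R of π at the places above p such that (1) the members of Δ occupy
--   consecutive positions of R at v, and (2) the point x_R lies OFF the Kedlaya–Pottharst–Xiao bad
--   locus: on the proper birational modification X' → X carrying the global triangulation
--   (KedlayaPottharstXiao2014 Cor 6.3.10, applied to the Johansson–Newton determinant family restricted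
--   to Γ_{K_v}, HansenUn

/-- item stmt-Langlands-3758 · crux · rank 5 · closed · moot by None · by planner
why it might fail: Label-flipped reducible/split ρ|Γ_{K_v} with the AHTW weights and Frobenius eigenvalues are weakly admissible when [K_v:ℚ_ℓ] ≥ 2 (signed gaps summing to [K_v:ℚ_ℓ]); only polarizable π (Caraiani2014) or ALT (YangLGC2024, weight 0) exclude them in print.
sources: AHTW2026, Caraiani2014, YangLGC2024, Colmez2010Linvariants, Nakamura2009, KedlayaPottharstXiao2014
[crux #5, typed n = 2 Galois-side shadow of #3+#4] K CM, π cuspidal on GL_2 with L-algebraic,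
regular and 2-REGULAR infinity type (no two exponents a at one embedding differ by 1 ⇔ every
labelled Hodge–Tate gap ≥ 2), ρ semisimple Satake-compatible a.e., v ∣ ℓ, and π_v special: some
local component πv with rec(πv) having N ≠ 0 for a LocalLanglandsDatum L of K_v (∀ L: the
IsLocalLanglandsGL axioms pin N on special classes through the degree of L(s, πv × χ)). CLAIM:
ρ|Γ_{K_v} is irreducible (no g conjugating it into upper-triangular form). Expected: if LGC holds,
D_st has N ≠ 0 and the N-stable line is an admissible sub-object iff Σ_τ g_τ = [K_v:ℚ_ℓ], impossible
for gaps ≥ 2 (for K_v = ℚ_p this is the irreducibility of semistable non-crystalline V_{k,𝓛}, k >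
2). In the route it follows from StrictTriangulationAtX + NonSplitGradedPiece (strictly trianguline
with slopes (s,−s), s > 0 ⇒ no étale saturated line). Refutable by exhibiting a reducible
ρ_π|Γ_{K_v} at a special place. [deps: NonSplitGradedPiece, StrictTriangulationAtX] [difficulty: L] -/
@[route_item "route-Langlands-WeightVelocityMonodromy"]
def LocalIrreducibilityGL2 : Prop :=
  ∀ (K : Type) [Field K] [NumberField K] [NumberField.IsCMField K] (hcpt : Literature.NumberTheory.Automorphic.isCompact_glFiniteIntegralLevel 2 K) (π : Literature.NumberTheory.Automorphic.CuspidalAutomorphicRepData 2 K hcpt) (T : Literature.NumberTheory.Automorphic.InfinityType K 2), π.1.HasInfinityType T → T.IsLAlgebraic → T.IsRegular → (∀ σ : K →+* ℂ, ∀ p ∈ T σ, ∀ q ∈ T σ, p.a - q.a ≠ 1) → ∀ (ℓ : ℕ) [Fact ℓ.Prime] (ι : PadicAlgCl ℓ ≃+* ℂ) (ρ : Literature.NumberTheory.GaloisRepresentations.FramedGaloisRep K (PadicAlgCl ℓ) 2), ρ.toGaloisRep.IsSemisimple → (∀ᶠ v : IsDedekindDomain.HeightOneSpectrum (NumberField.RingOfIntegers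 K) in Filter.cofinite, Summit.Langlands.SatakeFrobCompatibleAt ι π.1 ρ v) → ∀ v : IsDedekindDomain.HeightOneSpectrum (NumberField.RingOfIntegers K), ((ℓ : ℕ) : NumberField.RingOfIntegers K) ∈ v.asIdeal → ∀ (L : Literature.NumberTheory.Automorphic.LocalLanglandsDatum (v.adicCompletion K)) (πv : Literature.NumberTheory.Automorphic.SmoothIrrep (Matrix.GeneralLinearGroup (Fin 2) (v.adicCompletion K))), π.1.HasLocalComponentAt v πv.ρ → ((L.recGL 2 (Literature.NumberTheory.Automorphic.IrrClass.mk πv)).out.1).N ≠ 0 → ¬ ∃ g : Matrix.GeneralLinearGroup (Fin 2) (PadicAlgCl ℓ), ∀ σ : Field.absoluteGaloisGroup (v.adicCompletion K), ((Literature.NumberTheory.GaloisRepresentations.FramedRep.conj g (ρ.toLocal v) σ : Matrix.GeneralLinearGroup (Fin 2) (PadicAlgCl ℓ)) : Matrix (Fin 2) (Fin 2) (PadicAlgCl ℓ)) 1 0 = 0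

/-- item stmt-Langlands-3759 · crux · rank 6 · closed · moot by None · by planner
why it might fail: Nothing but reciprocity forbids ρ_π|Γ_{K_v} ≅ χ₁ ⊕ χ₂ for torsion-built π; at gap-1 labels slopes allow the split branch and for [K_v:ℚ_ℓ] ≥ 2 label-flipped split sums are weakly admissible, so the claim is genuinely beyond p-adic Hodge numerics.
sources: YangLGC2024, AllenNewton2020, AHTW2026, GreenbergStevens1993
[crux #6, typed n = 2 shadow of #3, ALL regular weights] Same hypotheses as LocalIrreducibilityGL2
WITHOUT 2-regularity. CLAIM: ρ|Γ_{K_v} is not a direct sum of two characters (no g conjugating it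
into diagonal form) when π_v is special. For gap-1 labels (weight-2 type) ρ|Γ_{K_v} is expected
reducible (ordinary/Tate-curve shape) but NON-SPLIT: the extension class is the non-crystalline
Kummer-type class, i.e. exactly c ≠ 0 of NonSplitGradedPiece for n = 2. Open in print for
non-polarizable π except weight 0 under the hypotheses of YangLGC2024 (automorphy lifting). A
counterexample (split ρ_π at a special place) contradicts reciprocity itself, so a refutation here
is a refutation of the summit's (A) for that π. [deps: NonSplitGradedPiece, StrictTriangulationAtX]
[difficulty: L] -/
@[route_item "route-Langlands-WeightVelocityMonodromy"]
def LocalIndecomposabilityGL2 : Prop :=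
  ∀ (K : Type) [Field K] [NumberField K] [NumberField.IsCMField K] (hcpt : Literature.NumberTheory.Automorphic.isCompact_glFiniteIntegralLevel 2 K) (π : Literature.NumberTheory.Automorphic.CuspidalAutomorphicRepData 2 K hcpt) (T : Literature.NumberTheory.Automorphic.InfinityType K 2), π.1.HasInfinityType T → T.IsLAlgebraic → T.IsRegular → ∀ (ℓ : ℕ) [Fact ℓ.Prime] (ι : PadicAlgCl ℓ ≃+* ℂ) (ρ : Literature.NumberTheory.GaloisRepresentations.FramedGaloisRep K (PadicAlgCl ℓ) 2), ρ.toGaloisRep.IsSemisimple → (∀ᶠ v : IsDedekindDomain.HeightOneSpectrum (NumberField.RingOfIntegers K) in Filter.cofinite, Summit.Langlands.SatakeFrobCompatibleAt ι π.1 ρ v) → ∀ v : IsDedekindDomain.HeightOneSpectrum (NumberField.RingOfIntegers K), ((ℓ : ℕ) : NumberField.RingOfIntegers K) ∈ v.asIdeal → ∀ (L : Literature.NumberTheory.Automorphic.LocalLanglandsDatum (v.adicCompletion K)) (πv : Literature.NumberTheory.Automorphic.SmoothIrrep (Matrix.GeneralLinearGroup (Fin 2) (v.adicCompletion K))), π.1.HasLocalComponentAt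 v πv.ρ → ((L.recGL 2 (Literature.NumberTheory.Automorphic.IrrClass.mk πv)).out.1).N ≠ 0 → ¬ ∃ g : Matrix.GeneralLinearGroup (Fin 2) (PadicAlgCl ℓ), ∀ σ : Field.absoluteGaloisGroup (v.adicCompletion K), ((Literature.NumberTheory.GaloisRepresentations.FramedRep.conj g (ρ.toLocal v) σ : Matrix.GeneralLinearGroup (Fin 2) (PadicAlgCl ℓ)) : Matrix (Fin 2) (Fin 2) (PadicAlgCl ℓ)) 0 1 = 0 ∧ ((Literature.NumberTheory.GaloisRepresentations.FramedRep.conj g (ρ.toLocal v) σ : Matrix.GeneralLinearGroup (Fin 2) (PadicAlgCl ℓ)) : Matrix (Fin 2) (Fin 2) (PadicAlgCl ℓ)) 1 0 = 0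

/-- item stmt-Langlands-2374 · support · rank 9 · open · by planner
sources: AHTW2026, VarmaFMS2024, BellaicheChenevier2009
[support] over an algebraically closed field of characteristic 0, two Frobenius-semisimple GENERIC
Weil–Deligne representations of W_F on the same space with equal traces of ρ(w) for all w are
isomorphic (ρ ≅ ρ' by Brauer–Nesbitt + "Φ-semisimple ⇒ semisimple"; generic ⇔ N in the open orbit of
the centraliser on {N}; the open orbit is unique). This is the lemma turning X + Varma's semisimple
compatibility into the summit's v ∤ ℓ clause; pure algebra, provable now. [difficulty: provable-now] -/
@[route_item "route-Langlands-WeightVelocityMonodromy"]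
def GenericWDUnique : Prop :=
  ∀ (F : Type) [Field F] [ValuativeRel F] [TopologicalSpace F] [IsNonarchimedeanLocalField F] (E : Type) [Field E] [IsAlgClosed E] [CharZero E] (n : ℕ) (W W' : Literature.NumberTheory.GaloisRepresentations.WeilDeligneRep F E (Fin n → E)), W.IsFrobSemisimple → W'.IsFrobSemisimple → (∀ w : Literature.NumberTheory.GaloisRepresentations.WeilGroup F, LinearMap.trace E (Fin n → E) (W.ρ w) = LinearMap.trace E (Fin n → E) (W'.ρ w)) → (∀ f : (Fin n → E) →ₗ[E] (Fin n → E), (∀ w : Literature.NumberTheory.GaloisRepresentations.WeilGroup F, f ∘ₗ W.ρ w = ((Literature.NumberTheory.GaloisRepresentations.IsNonarchimedeanLocalField.residueFieldCard F : E) ^ (Literature.NumberTheory.GaloisRepresentations.WeilGroup.deg w)) • (W.ρ w ∘ₗ f)) → f ∘ₗ W.N = W.N ∘ₗ f → f = 0) → (∀ f : (Fin n → E) →ₗ[E] (Fin n → E), (∀ w : Literature.NumberTheory.GaloisRepresentations.WeilGroup F, f ∘ₗ W'.ρ w = ((Literature.NumberTheory.GaloisRepresentations.IsNonarchimedeanLocalField.residueFieldCard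 F : E) ^ (Literature.NumberTheory.GaloisRepresentations.WeilGroup.deg w)) • (W'.ρ w ∘ₗ f)) → f ∘ₗ W'.N = W'.N ∘ₗ f → f = 0) → W.IsEquivalent W'

/-- item stmt-Langlands-3760 · support · rank 9 · closed · moot by None · by planner
sources: AHTW2026, VarmaFMS2024
[support, typed rendering of a PRINTED theorem; cite item filed] AHTW2026 Thm 1.2.1 + Cor 1.2.2 (=
Cor 6.0.6) in the summit's idiom, ∃Rec form with the SAME witness shape as LocalGlobalCompatibleAt:
for K CM, ∃Rec, for regular L-algebraic cuspidal π, semisimple Satake-compatible ρ, v ∣ ℓ: ∃ πv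
(local component), r with IsWeilDeligneOf (ρ|v) r, rC = ι(r), such that (i) charpoly(rC.ρ w) =
charpoly(rec(πv).ρ w) for all w ∈ W_{K_v} (⇔ same semisimplification, char 0) and (ii) rank rC.N^k ≤
rank rec(πv).N^k for all k (the rank shadow of ≺, AHTW2026 Def 6.0.2; ≺ proper is per
unramified-twist class ω). Unprovable in the tree until the genuine Rec exists (B_dR, WD∘D_pst:
definition items); the Assembly needs it for the genuine datum, i.e. as a Literature named fact `(h
: AHTW…) →`, which is what the cite item requests. [difficulty: XL (formalisation of a 118-page 2026
preprint: named fact only)] -/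
@[route_item "route-Langlands-WeightVelocityMonodromy"]
def AHTWSemisimpleLGC : Prop :=
  ∀ (K : Type) [Field K] [NumberField K] [NumberField.IsCMField K], ∃ Rec : Summit.Langlands.ReciprocityData K, ∀ (n : ℕ) (hcpt : Literature.NumberTheory.Automorphic.isCompact_glFiniteIntegralLevel n K) (π : Literature.NumberTheory.Automorphic.CuspidalAutomorphicRepData n K hcpt) (T : Literature.NumberTheory.Automorphic.InfinityType K n), π.1.HasInfinityType T → T.IsLAlgebraic → T.IsRegular → ∀ (ℓ : ℕ) [Fact ℓ.Prime] (ι : PadicAlgCl ℓ ≃+* ℂ) (ρ : Literature.NumberTheory.GaloisRepresentations.FramedGaloisRep K (PadicAlgCl ℓ) n), ρ.toGaloisRep.IsSemisimple → (∀ᶠ v : IsDedekindDomain.HeightOneSpectrum (NumberField.RingOfIntegers K) in Filter.cofinite, Summit.Langlands.SatakeFrobCompatibleAt ι π.1 ρ v) → ∀ v : IsDedekindDomain.HeightOneSpectrum (NumberField.RingOfIntegers K), ((ℓ : ℕ) : NumberField.RingOfIntegers K) ∈ v.asIdeal → ∃ (πv : Literature.NumberTheory.Automorphic.SmoothIrrep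 (Matrix.GeneralLinearGroup (Fin n) (v.adicCompletion K))) (r : Literature.NumberTheory.GaloisRepresentations.WeilDeligneRep (v.adicCompletion K) (PadicAlgCl ℓ) (Fin n → PadicAlgCl ℓ)) (rC : Literature.NumberTheory.GaloisRepresentations.WeilDeligneRep (v.adicCompletion K) ℂ (Fin n → ℂ)), π.1.HasLocalComponentAt v πv.ρ ∧ (∀ hv : ((ℓ : ℕ) : NumberField.RingOfIntegers K) ∈ v.asIdeal, (Rec.pst ℓ v hv).IsWeilDeligneOf (ρ.toLocal v) r) ∧ r.IsTransportAlong (ι : PadicAlgCl ℓ →+* ℂ) rC ∧ (∀ w : Literature.NumberTheory.GaloisRepresentations.WeilGroup (v.adicCompletion K), LinearMap.charpoly (rC.ρ w) = LinearMap.charpoly (((Rec.llc v).recGL n (Literature.NumberTheory.Automorphic.IrrClass.mk πv)).out.1.ρ w)) ∧ ∀ k : ℕ, Module.finrank ℂ (LinearMap.range (rC.N ^ k)) ≤ Module.finrank ℂ (LinearMap.range ((((Rec.llc v).recGL n (Literature.NumberTheory.Automorphic.IrrClass.mk πv)).out.1).N ^ k))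

/-- item stmt-Langlands-3761 · support · rank 9 · closed · moot by None · by planner
sources: Ding2019SimpleL, BellaicheChenevier2009
[support, typed, provable now] Pure matrix algebra behind 'N ≠ 0 on every consecutive graded piece
of a segment ⇒ Jordan type ≥ the segment partition' (Ding2019SimpleL Lem 3.2 generalised to several
segments): N strictly upper triangular n×n over a field (N i j = 0 for j ≤ i), seg : Fin n → ℕ
monotone (block labels), superdiagonal entries N i (i+1) ≠ 0 whenever seg i = seg (i+1). Then for
every k, #{i : i+k < n, seg i = seg (i+k)} ≤ rank N^k. Proof: (N^k)_{i,i+k} = ∏ of the k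
superdiagonal entries ≠ 0 and N^k is k-strictly upper triangular, so the rows i / columns i+k
submatrix over that index set is triangular with non-zero diagonal. ≤ 40 lines of Lean
(Matrix.toLin', finrank_range, rank ≥ rank of an invertible submatrix). [difficulty: provable-now] -/
@[route_item "route-Langlands-WeightVelocityMonodromy"]
def MonodromyRankFromChain : Prop :=
  ∀ (E : Type) [Field E] (n : ℕ) (N : Matrix (Fin n) (Fin n) E) (seg : Fin n → ℕ), Monotone seg → (∀ i j : Fin n, j.val ≤ i.val → N i j = 0) → (∀ i j : Fin n, i.val + 1 = j.val → seg i = seg j → N i j ≠ 0) → ∀ k : ℕ, (Finset.univ.filter fun i : Fin n => ∃ j : Fin n, i.val + k = j.val ∧ seg i = seg j).card ≤ Module.finrank E (LinearMap.range (Matrix.toLin' (N ^ k)))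

-- item stmt-Langlands-3882 · support · rank 9 · closed · moot by None · by planner — informal only, no Lean statement yet:
--   [support — CGS ARC ORTHOGONALITY, KNOWN in print; informal until PhiGammaModuleRobba lands] The
--   engine (Colmez–Greenberg–Stevens): let A = E[ε]/ε² (or E[s]/s^{m+1} pulled back along ε ↦ s^m, which
--   turns the leading-order jet of an arc into a first-order jet), D_A a rank-n triangulable
--   (φ,Γ_{K_v})-module over R_A with parameters δ_{A,j}, D = D_A mod ε with δ_j, and i such that
--   δ_i/δ_{i+1} is special and gr_i D non-split with class c_i. If δ̃_iδ̃_{i+1}^{-1} = δ_iδ_{i+1}^{-1}(1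
--   + εψ), ψ ∈ Hom(K_v^×, E), then ⟨c_i, ψ⟩ = 0 for the cup product H¹(R_E(δ_iδ_{i+1}^{-1})) × H¹(R_E) →
--   H²(R_E(δ_iδ_{i+1}^{

/-- item stmt-Langlands-5579 · support · rank 9 · closed · moot by None · by planner
[support · route-repair 2026-08-15 · needs-fact] The ONLY unproved named facts of the import cone
that any item of this route rests on are the two Statement-level existence facts an ∃Rec statement
(MonodromyAtP, AHTWSemisimpleLGC — and the summit itself) must use to inhabit `ReciprocityData K`:
needs-fact: Literature.NumberTheory.Automorphic.LocalLanglandsDatum.nonempty (Harris–Taylor 2001 Thm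
A / Henniart 2000 Thm 1.2: local Langlands data for GL_n(K_v) exist) and needs-fact:
Literature.NumberTheory.GaloisRepresentations.PstWeilDeligneData.nonempty (Fontaine: B_dR / WD∘D_pst
data exist; in substance the definition items FontainePstData). CLAIM (glue, provable now:
Classical.choice twice, CharZero K_v from injectivity of algebraMap K → K_v): given both facts and a
ℚ_ℓ-algebra structure on each completion K_v with v ∣ ℓ (the canonical one is not yet in the tree;
PstWeilDeligneData.nonempty takes it as an argument), ReciprocityData K is inhabited for every
number field K. The Assembly needs neither fact (Rec comes from its AHTWSemisimpleLGC hypothesis);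
the other 19 unproved cone facts (exists_galoisRep_of_regularAlgebraic,
potentiallyModular_ellipticCurve_CM, Isogeny/Faltings, Borel -/
@[route_item "route-Langlands-WeightVelocityMonodromy"]
def RecFromFacts : Prop :=
  Literature.NumberTheory.Automorphic.LocalLanglandsDatum.nonempty → Literature.NumberTheory.GaloisRepresentations.PstWeilDeligneData.nonempty → ∀ (K : Type) [Field K] [NumberField K], (∀ (ℓ : ℕ) [Fact ℓ.Prime] (v : IsDedekindDomain.HeightOneSpectrum (NumberField.RingOfIntegers K)), ((ℓ : ℕ) : NumberField.RingOfIntegers K) ∈ v.asIdeal → Algebra ℚ_[ℓ] (v.adicCompletion K)) → Nonempty (Summit.Langlands.ReciprocityData K)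

-- TODO item stmt-Langlands-3757 · assembly · rank 1 · closed · moot by None · by planner — BLOCKED: missing decl(s) CGSArcOrthogonality, NonSplitGradedPiece, StrictTriangulationAtX, WeightVelocityAtSteinbergPairs; restate via `ledger route edit` once they land:
--   def Assembly : Prop := WeightVelocityAtSteinbergPairs → NonSplitGradedPiece → StrictTriangulationAtX → CGSArcOrthogonality → AHTWSemisimpleLGC → MonodromyRankFromChain → GenericWDUnique → LocalIrreducibilityGL2 ∧ LocalIndecomposabilityGL2 ∧ MonodromyAtP

end Summit.Langlands.Langlands.Theses.WeightVelocityMonodromy
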